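import Summits.FinalStateConjecture.FinalStateConjecture.Theorems.EIHFluxBalanceInertialRecessionRechartCausalKit
import Literature.Geometry.Lorentzian.KerrConvergenceProofs

/-!
# Route EIHFluxBalance — `InertialRecession`, re-charting: reaching a tilted hole slab causally
# (certified static orbits + near-horizon loitering)

Helper file for the crux `stmt-FinalStateConjecture-10166`
(`Summit.FinalStateConjecture.FinalStateConjecture.Theses.EIHFluxBalance.InertialRecession`),
stub `stub_rechart` (the transfer P2 of line `sublinear-is-free-clean-window-charges`).

Clause (ii) of `HasExhaustiveCharts` for a re-charted decomposition asks that a point of a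
hole chart's image whose hole time `t*` lags the chart time `τ₁` lie in the causal past of the
CERTIFIED hole slab `ψ({t* = τ₁, r ≤ R(τ₁)})`. This file proves that for an abstract hole chart
`ψ : Kb.domain → M` on a reference background `Kb` with a "static direction" `u` (translating
`Kb.domain` into itself, raising `Kb.time` at unit rate and preserving `Kb.radius` — for boosted
Kerr, `u = Λ e₀`):

* `mem_causalPast_image_truncTimeSlab_of_orbit` — if the push-forward `dψ(u)` is future-directed
  causal on `{S₀ ≤ t*, r₁ ≤ r ≤ R(t*)}` (the CERTIFIED zone; for the re-charted hole charts this is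
  `C⁰`-closeness to Kerr–Schild away from the horizon plus future-orientation of the lab chart),
  the static orbit `σ ↦ ψ(y + σu)` is a future causal curve carrying `y` to the slab `{t* = τ₁}`
  inside radius `R(τ₁)` (`R` monotone);
* `mem_causalPast_image_truncTimeSlab_of_loiter` — below radius `r₁` (the uncertifiable layer
  above the painted horizon) the same conclusion from a LOITERING hypothesis stated on the LAB
  chart `Φ` (a future causal curve from the lab point that raises lab time by any prescribed
  amount while staying within painted radius `K` of the hole and outside its painted horizon),
  a lab↔model dictionary (coverage of the painted near zone by `ψ` with
  `|t* − α·(lab time)| ≤ β·(painted radius)`), injectivity of `ψ` and the intermediate value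
  theorem along the curve (`exists_mem_Icc_apply_eq_of_curve`);
* `mem_causalPast_image_truncTimeSlab` — the two cases combined.

[O'Neill 1983, Ch. 14; folklore causal bookkeeping]
-/

noncomputable section

set_option linter.dupNamespace false

open Set Filter Topology Function TopologicalSpace Literature.Geometry.Lorentzian
open scoped Manifold ContDiff

namespace Summit.FinalStateConjecture.FinalStateConjecture.Theorems

/-! ### Static orbits of a reference background -/

section Orbit

variable {𝓢 : Spacetime 4} (Kb : ModelBackground) (u : E4)
  (hdom : ∀ x : E4, x ∈ Kb.domain → ∀ σ : ℝ, x + σ • u ∈ Kb.domain)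
  (htime : ∀ (x : E4) (σ : ℝ), Kb.time (x + σ • u) = Kb.time x + σ)
  (hrad : ∀ (x : E4) (σ : ℝ), Kb.radius (x + σ • u) = Kb.radius x)
  (ψ : Kb.domain → 𝓢.carrier) (hψ : ContMDiff 𝓘(ℝ, E4) (𝓡 4) ∞ ψ)

include hdom in
/-- The static orbit through `y ∈ Kb.domain`, as a smooth curve into the open submanifold
`Kb.domain`, has velocity `u`: `d(ψ ∘ orbit)(σ)(1) = dψ(y + σu)(u)`. [folklore] -/
theorem mfderiv_comp_orbit_apply_one (hψ : ContMDiff 𝓘(ℝ, E4) (𝓡 4) ∞ ψ) (y : Kb.domain)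
    (σ : ℝ) :
    MDifferentiableAt 𝓘(ℝ, ℝ) (𝓡 4)
        (fun s : ℝ ↦ ψ ⟨y.1 + s • u, hdom y.1 y.2 s⟩) σ ∧
      mfderiv 𝓘(ℝ, ℝ) (𝓡 4) (fun s : ℝ ↦ ψ ⟨y.1 + s • u, hdom y.1 y.2 s⟩) σ (1 : ℝ) =
        mfderiv 𝓘(ℝ, E4) (𝓡 4) ψ ⟨y.1 + σ • u, hdom y.1 y.2 σ⟩ u := by
  set c : ℝ → Kb.domain := fun s ↦ ⟨y.1 + s • u, hdom y.1 y.2 s⟩ with hc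
  have ha : ContDiff ℝ ∞ (fun s : ℝ ↦ y.1 + s • u) :=
    contDiff_const.add (contDiff_id.smul contDiff_const)
  have hval : ContMDiff 𝓘(ℝ, ℝ) 𝓘(ℝ, E4) ∞ (Subtype.val ∘ c) := contMDiff_iff_contDiff.mpr ha
  have hcs : ContMDiff 𝓘(ℝ, ℝ) 𝓘(ℝ, E4) ∞ c := (ContMDiff.subtypeVal_comp_iff Kb.domain c).1 hval
  have h2 : MDifferentiableAt 𝓘(ℝ, ℝ) 𝓘(ℝ, E4) c σ := hcs.mdifferentiableAt (by simp)
  have h3 : MDifferentiableAt 𝓘(ℝ, E4) (𝓡 4) ψ (c σ) := hψ.mdifferentiableAt (by simp)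
  refine ⟨h3.comp σ h2, ?_⟩
  -- velocity of `c`
  have hvel : mfderiv 𝓘(ℝ, ℝ) 𝓘(ℝ, E4) c σ (1 : ℝ) = u := by
    have h1 : MDifferentiableAt 𝓘(ℝ, E4) 𝓘(ℝ, E4) (Subtype.val : Kb.domain → E4) (c σ) :=
      (contMDiff_subtype_val (n := ∞)).mdifferentiableAt (by simp)
    have hcomp := mfderiv_comp σ h1 h2
    have hfd : mfderiv 𝓘(ℝ, ℝ) 𝓘(ℝ, E4) (Subtype.val ∘ c) σ (1 : ℝ) = u := by
      rw [mfderiv_eq_fderiv]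
      have hd : HasFDerivAt (fun s : ℝ ↦ y.1 + s • u)
          ((ContinuousLinearMap.id ℝ ℝ).smulRight u) σ :=
        ((hasFDerivAt_id σ).smul_const u).const_add y.1
      rw [show (Subtype.val ∘ c) = fun s : ℝ ↦ y.1 + s • u from rfl, hd.fderiv]
      show ((ContinuousLinearMap.id ℝ ℝ) (1 : ℝ)) • u = u
      rw [ContinuousLinearMap.id_apply, one_smul]
    rw [hcomp] at hfd
    have e1 := OpensChart.mfderiv_subtypeVal_apply (c σ) (mfderiv 𝓘(ℝ, ℝ) 𝓘(ℝ, E4) c σ (1 : ℝ))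
    exact e1.symm.trans hfd
  have hcomp2 := mfderiv_comp σ h3 h2
  rw [show (fun s : ℝ ↦ ψ ⟨y.1 + s • u, hdom y.1 y.2 s⟩) = ψ ∘ c from rfl, hcomp2]
  show mfderiv 𝓘(ℝ, E4) (𝓡 4) ψ (c σ) (mfderiv 𝓘(ℝ, ℝ) 𝓘(ℝ, E4) c σ (1 : ℝ)) = _
  rw [hvel]

include hdom htime hrad hψ in
/-- **Static orbits reach the tilted slab.** If `dψ(u)` is future-directed causal at every point
of `Kb.domain` with `S₀ ≤ t*`, `r₁ ≤ r` and `r ≤ R(t*)` (`R` monotone), then every such point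
`y` with `t*(y) ≤ τ₁` lies in `J⁻(ψ({t* = τ₁, r ≤ R(τ₁)}))`: follow the orbit `σ ↦ ψ(y + σu)`
for `σ ∈ [0, τ₁ − t*(y)]`. [folklore] -/
theorem mem_causalPast_image_truncTimeSlab_of_orbit (R : ℝ → ℝ) (hRm : Monotone R)
    {r₁ S₀ : ℝ}
    (hKO : ∀ y : Kb.domain, S₀ ≤ Kb.time y.1 → r₁ ≤ Kb.radius y.1 →
      Kb.radius y.1 ≤ R (Kb.time y.1) →
        𝓢.timeOrientation.IsFutureDirected (mfderiv 𝓘(ℝ, E4) (𝓡 4) ψ y u))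
    (y : Kb.domain) (hyS : S₀ ≤ Kb.time y.1) (hyr : r₁ ≤ Kb.radius y.1)
    (hyR : Kb.radius y.1 ≤ R (Kb.time y.1)) {τ₁ : ℝ} (hy₁ : Kb.time y.1 ≤ τ₁) :
    ψ y ∈ 𝓢.metric.causalPast 𝓢.timeOrientation (ψ '' Kb.truncTimeSlab (R τ₁) τ₁) := by
  set L : ℝ := τ₁ - Kb.time y.1 with hL
  have hL0 : 0 ≤ L := by rw [hL]; linarith
  set γ : ℝ → 𝓢.carrier := fun s ↦ ψ ⟨y.1 + s • u, hdom y.1 y.2 s⟩ with hγ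
  have hγ0 : γ 0 = ψ y := by
    simp [hγ]
  have hcurve : 𝓢.metric.IsFutureCausalCurveOn 𝓢.timeOrientation γ (Icc 0 L) := by
    intro s hs
    obtain ⟨hd, hv⟩ := mfderiv_comp_orbit_apply_one Kb u hdom ψ hψ y s
    refine ⟨hd, ?_⟩
    show 𝓢.timeOrientation.IsFutureDirected (mfderiv 𝓘(ℝ, ℝ) (𝓡 4) γ s (1 : ℝ))
    rw [hγ, hv]
    refine hKO _ ?_ ?_ ?_
    · show S₀ ≤ Kb.time (y.1 + s • u)
      rw [htime]; linarith [hs.1]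
    · show r₁ ≤ Kb.radius (y.1 + s • u)
      rw [hrad]; exact hyr
    · show Kb.radius (y.1 + s • u) ≤ R (Kb.time (y.1 + s • u))
      rw [hrad, htime]
      exact hyR.trans (hRm (by linarith [hs.1]))
  have hend : γ L ∈ ψ '' Kb.truncTimeSlab (R τ₁) τ₁ := by
    refine ⟨⟨y.1 + L • u, hdom y.1 y.2 L⟩, ?_, rfl⟩
    rw [ModelBackground.mem_truncTimeSlab]
    refine ⟨?_, ?_⟩
    · show Kb.time (y.1 + L • u) = τ₁
      rw [htime, hL]; ring
    · show Kb.radius (y.1 + L • u) ≤ R τ₁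
      rw [hrad]; exact hyR.trans (hRm hy₁)
  rw [← hγ0]
  exact mem_causalPast_of_curve hcurve ⟨hL0, le_rfl⟩ hend

end Orbit

/-! ### Loitering near the horizon, read on the lab chart -/

section Loiter

variable {𝓢 : Spacetime 4} (Kb : ModelBackground) (ψ : Kb.domain → 𝓢.carrier)
  (hemb : IsOpenEmbedding ψ) (hcont : Continuous Kb.time)
  (U : Opens E4) (Φ : U → 𝓢.carrier) (rp : U → ℝ) (Pext : U → Prop)
  (R : ℝ → ℝ) {rH δ K TH Tc S₁ α β : ℝ} (hβ : 0 ≤ β) (hα : 0 < α) (hδK : rH + δ ≤ K)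
  -- loitering, on the lab chart
  (hHov : ∀ x : U, TH < x.1 0 → Pext x → rp x < rH + δ → ∀ s : ℝ, 0 < s →
    ∃ (γ : ℝ → 𝓢.carrier) (b : ℝ), 0 < b ∧
      𝓢.metric.IsFutureCausalCurveOn 𝓢.timeOrientation γ (Icc 0 b) ∧ γ 0 = Φ x ∧
      γ b ∈ Φ '' {z : U | z.1 0 = x.1 0 + s ∧ rH < rp z ∧ rp z < K} ∧
      ∀ σ ∈ Icc 0 b, γ σ ∈ Φ '' {z : U | x.1 0 ≤ z.1 0 ∧ rH < rp z ∧ rp z < K})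
  -- coverage of the painted near zone by the hole chart, with the time dictionary
  (hcov : ∀ z : U, Tc ≤ z.1 0 → rH < rp z → rp z < K →
    ∃ y : Kb.domain, ψ y = Φ z ∧ Kb.radius y.1 = rp z ∧ |Kb.time y.1 - α * z.1 0| ≤ β * rp z)
  -- lab description of the near-horizon points of the hole chart
  (hlab : ∀ y : Kb.domain, S₁ ≤ Kb.time y.1 → Kb.radius y.1 < rH + δ →
    ∃ x : U, Φ x = ψ y ∧ TH < x.1 0 ∧ Tc ≤ x.1 0 ∧ Pext x ∧ rp x = Kb.radius y.1 ∧
      |Kb.time y.1 - α * x.1 0| ≤ β * rp x)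

include hemb hcont hβ hα hδK hHov hcov hlab in
/-- **Loitering reaches the tilted slab.** A near-horizon point `y` of the hole chart
(`r(y) < rH + δ`, `S₁ ≤ t*(y) ≤ τ₁`) lies in `J⁻(ψ({t* = τ₁, r ≤ R(τ₁)}))` as soon as
`K ≤ R(τ₁)`: its lab point loiters (hypothesis `hHov`) up to a lab time at which every point of
the painted near zone `{rH < r_p < K}` has hole time `> τ₁`; hole time, read along the curve
through `ψ⁻¹` (coverage + injectivity), is continuous and hits `τ₁` exactly at a point of radius
`< K`. [folklore] -/
theorem mem_causalPast_image_truncTimeSlab_of_loiter (y : Kb.domain) (hyS : S₁ ≤ Kb.time y.1)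
    (hyδ : Kb.radius y.1 < rH + δ) {τ₁ : ℝ} (hy₁ : Kb.time y.1 ≤ τ₁) (hKR : K ≤ R τ₁) :
    ψ y ∈ 𝓢.metric.causalPast 𝓢.timeOrientation (ψ '' Kb.truncTimeSlab (R τ₁) τ₁) := by
  obtain ⟨x, hxψ, hxT, hxc, hxP, hxr, hxt⟩ := hlab y hyS hyδ
  -- the lab lapse
  set s : ℝ := (τ₁ + β * K + 1) / α - x.1 0 with hs
  have hs0 : 0 < s := by
    have h1 : α * x.1 0 ≤ Kb.time y.1 + β * rp x := by
      have := (abs_le.mp hxt).1; linarith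
    have h2 : β * rp x ≤ β * K := by
      refine mul_le_mul_of_nonneg_left ?_ hβ
      rw [hxr]; linarith
    have h3 : α * x.1 0 < τ₁ + β * K + 1 := by linarith
    rw [hs, sub_pos, lt_div_iff₀ hα]
    linarith
  obtain ⟨γ, b, hb, hγ, hγ0, hγb, hγin⟩ := hHov x hxT hxP (by rw [hxr]; exact hyδ) s hs0
  -- the end point has hole time `> τ₁`
  obtain ⟨zb, ⟨hzb0, hzb1, hzb2⟩, hzbγ⟩ := hγb
  obtain ⟨yb, hybψ, hybr, hybt⟩ := hcov zb (by rw [hzb0]; linarith) hzb1 hzb2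
  have hybτ : τ₁ ≤ Kb.time yb.1 := by
    have h1 := (abs_le.mp hybt).1
    have h2 : β * rp zb ≤ β * K := mul_le_mul_of_nonneg_left hzb2.le hβ
    have h3 : α * zb.1 0 = τ₁ + β * K + 1 := by
      rw [hzb0, hs]; field_simp; ring
    linarith
  -- the curve runs inside `range ψ`
  have hrange : MapsTo γ (Icc 0 b) (range ψ) := by
    intro σ hσ
    obtain ⟨z, ⟨hz0, hz1, hz2⟩, hzγ⟩ := hγin σ hσ
    obtain ⟨y', hy'ψ, -, -⟩ := hcov z (hxc.trans hz0) hz1 hz2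
    exact ⟨y', hy'ψ.trans hzγ⟩
  -- intermediate value: hole time `τ₁` is hit along the curve
  have hcts : Continuous fun y : Kb.domain ↦ Kb.time y.1 := hcont.comp continuous_subtype_val
  obtain ⟨σ₀, hσ₀, y₀, hy₀γ, hy₀t⟩ := exists_mem_Icc_apply_eq_of_curve hemb hb.le
    (continuousOn_of_isFutureCausalCurveOn hγ) hrange hcts (xa := y) (xb := yb)
    (by rw [hγ0, hxψ]) (by rw [hybψ, hzbγ]) hy₁ hybτ
  -- the hit point has radius `< K ≤ R τ₁`
  obtain ⟨z₀, ⟨hz₀0, hz₀1, hz₀2⟩, hz₀γ⟩ := hγin σ₀ hσ₀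
  obtain ⟨y₀', hy₀'ψ, hy₀'r, -⟩ := hcov z₀ (hxc.trans hz₀0) hz₀1 hz₀2
  have hyy : y₀ = y₀' := hemb.injective (hy₀γ.trans (hz₀γ.symm.trans hy₀'ψ.symm))
  have hmem : γ σ₀ ∈ ψ '' Kb.truncTimeSlab (R τ₁) τ₁ := by
    refine ⟨y₀, ?_, hy₀γ⟩
    rw [ModelBackground.mem_truncTimeSlab]
    refine ⟨hy₀t, ?_⟩
    rw [hyy, hy₀'r]
    linarith
  rw [← hxψ, ← hγ0]
  exact mem_causalPast_of_curve hγ hσ₀ hmem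

end Loiter

/-! ### The two cases combined -/

section Combined

variable {𝓢 : Spacetime 4} (Kb : ModelBackground) (u : E4)
  (hdom : ∀ x : E4, x ∈ Kb.domain → ∀ σ : ℝ, x + σ • u ∈ Kb.domain)
  (htime : ∀ (x : E4) (σ : ℝ), Kb.time (x + σ • u) = Kb.time x + σ)
  (hrad : ∀ (x : E4) (σ : ℝ), Kb.radius (x + σ • u) = Kb.radius x)
  (ψ : Kb.domain → 𝓢.carrier) (hψ : ContMDiff 𝓘(ℝ, E4) (𝓡 4) ∞ ψ)
  (hemb : IsOpenEmbedding ψ) (hcont : Continuous Kb.time)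
  (U : Opens E4) (Φ : U → 𝓢.carrier) (rp : U → ℝ) (Pext : U → Prop)
  (R : ℝ → ℝ) (hRm : Monotone R) {rH δ K TH Tc S₀ S₁ α β : ℝ} (hβ : 0 ≤ β) (hα : 0 < α)
  (hδK : rH + δ ≤ K)
  (hKO : ∀ y : Kb.domain, S₀ ≤ Kb.time y.1 → rH + δ ≤ Kb.radius y.1 →
    Kb.radius y.1 ≤ R (Kb.time y.1) →
      𝓢.timeOrientation.IsFutureDirected (mfderiv 𝓘(ℝ, E4) (𝓡 4) ψ y u))
  (hHov : ∀ x : U, TH < x.1 0 → Pext x → rp x < rH + δ → ∀ s : ℝ, 0 < s →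
    ∃ (γ : ℝ → 𝓢.carrier) (b : ℝ), 0 < b ∧
      𝓢.metric.IsFutureCausalCurveOn 𝓢.timeOrientation γ (Icc 0 b) ∧ γ 0 = Φ x ∧
      γ b ∈ Φ '' {z : U | z.1 0 = x.1 0 + s ∧ rH < rp z ∧ rp z < K} ∧
      ∀ σ ∈ Icc 0 b, γ σ ∈ Φ '' {z : U | x.1 0 ≤ z.1 0 ∧ rH < rp z ∧ rp z < K})
  (hcov : ∀ z : U, Tc ≤ z.1 0 → rH < rp z → rp z < K →
    ∃ y : Kb.domain, ψ y = Φ z ∧ Kb.radius y.1 = rp z ∧ |Kb.time y.1 - α * z.1 0| ≤ β * rp z)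
  (hlab : ∀ y : Kb.domain, S₁ ≤ Kb.time y.1 → Kb.radius y.1 < rH + δ →
    ∃ x : U, Φ x = ψ y ∧ TH < x.1 0 ∧ Tc ≤ x.1 0 ∧ Pext x ∧ rp x = Kb.radius y.1 ∧
      |Kb.time y.1 - α * x.1 0| ≤ β * rp x)

include hdom htime hrad hψ hemb hcont hRm hβ hα hδK hKO hHov hcov hlab in
/-- **Every late point of the hole chart below radius `R(t*)` and of hole time `≤ τ₁` lies in
the causal past of the certified slab `ψ({t* = τ₁, r ≤ R(τ₁)})`** (static orbit above radius
`rH + δ`, loitering below), provided `K ≤ R(τ₁)`. [folklore] -/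
theorem mem_causalPast_image_truncTimeSlab (y : Kb.domain) (hyS₀ : S₀ ≤ Kb.time y.1)
    (hyS₁ : S₁ ≤ Kb.time y.1) (hyR : Kb.radius y.1 ≤ R (Kb.time y.1)) {τ₁ : ℝ}
    (hy₁ : Kb.time y.1 ≤ τ₁) (hKR : K ≤ R τ₁) :
    ψ y ∈ 𝓢.metric.causalPast 𝓢.timeOrientation (ψ '' Kb.truncTimeSlab (R τ₁) τ₁) := by
  rcases le_or_gt (rH + δ) (Kb.radius y.1) with h | h
  · exact mem_causalPast_image_truncTimeSlab_of_orbit Kb u hdom htime hrad ψ hψ R hRm hKO y hyS₀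
      h hyR hy₁
  · exact mem_causalPast_image_truncTimeSlab_of_loiter Kb ψ hemb hcont U Φ rp Pext R hβ hα hδK
      hHov hcov hlab y hyS₁ h hy₁ hKR

/-- Registered one-line form (stub `hover_mem_causalPast_truncTimeSlab` of the crux item) of
`mem_causalPast_image_truncTimeSlab`. [folklore] -/
theorem hover_mem_causalPast_truncTimeSlab : open Literature.Geometry.Lorentzian Set Topology in ∀ {𝓢 : Spacetime 4} (Kb : ModelBackground) (u : E4), (∀ x : E4, x ∈ Kb.domain → ∀ σ : ℝ, x + σ • u ∈ Kb.domain) → (∀ (x : E4) (σ : ℝ), Kb.time (x + σ • u) = Kb.time x + σ) → (∀ (x : E4) (σ : ℝ), Kb.radius (x + σ • u) = Kb.radius x) → ∀ (ψ : Kb.domain → 𝓢.carrier), ContMDiff 𝓘(ℝ, E4) (𝓡 4) ((⊤ : ℕ∞) : WithTop ℕ∞) ψ → IsOpenEmbedding ψ → Continuous Kb.time → ∀ (U : TopologicalSpace.Opens E4) (Φ : U → 𝓢.carrier) (rp : U → ℝ) (Pext : U → Prop) (R : ℝ → ℝ), Monotone R → ∀ {rH δ K TH Tc S₀ S₁ α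 β : ℝ}, 0 ≤ β → 0 < α → rH + δ ≤ K → (∀ y : Kb.domain, S₀ ≤ Kb.time y.1 → rH + δ ≤ Kb.radius y.1 → Kb.radius y.1 ≤ R (Kb.time y.1) → 𝓢.timeOrientation.IsFutureDirected (mfderiv 𝓘(ℝ, E4) (𝓡 4) ψ y u)) → (∀ x : U, TH < x.1 0 → Pext x → rp x < rH + δ → ∀ s : ℝ, 0 < s → ∃ (γ : ℝ → 𝓢.carrier) (b : ℝ), 0 < b ∧ 𝓢.metric.IsFutureCausalCurveOn 𝓢.timeOrientation γ (Icc 0 b) ∧ γ 0 = Φ x ∧ γ b ∈ Φ '' {z : U | z.1 0 = x.1 0 + s ∧ rH < rp z ∧ rp z < K} ∧ ∀ σ ∈ Icc 0 b, γ σ ∈ Φ '' {z : U | x.1 0 ≤ z.1 0 ∧ rH < rp z ∧ rp z < K}) → (∀ z : U, Tc ≤ z.1 0 → rH < rp z → rp z < K → ∃ y : Kb.domain, ψ y = Φ z ∧ Kb.radius y.1 = rp z ∧ |Kb.time y.1 - α * z.1 0| ≤ β * rp z) → (∀ y : Kb.domain, S₁ ≤ Kb.time y.1 → Kb.radius y.1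 < rH + δ → ∃ x : U, Φ x = ψ y ∧ TH < x.1 0 ∧ Tc ≤ x.1 0 ∧ Pext x ∧ rp x = Kb.radius y.1 ∧ |Kb.time y.1 - α * x.1 0| ≤ β * rp x) → ∀ (y : Kb.domain), S₀ ≤ Kb.time y.1 → S₁ ≤ Kb.time y.1 → Kb.radius y.1 ≤ R (Kb.time y.1) → ∀ {τ₁ : ℝ}, Kb.time y.1 ≤ τ₁ → K ≤ R τ₁ → ψ y ∈ 𝓢.metric.causalPast 𝓢.timeOrientation (ψ '' Kb.truncTimeSlab (R τ₁) τ₁) :=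
  fun Kb u hdom htime hrad ψ hψ hemb hcont U Φ rp Pext R hRm _ _ _ _ _ _ _ _ _ hβ hα hδK hKO hHov
      hcov hlab y hyS₀ hyS₁ hyR _ hy₁ hKR ↦
    mem_causalPast_image_truncTimeSlab Kb u hdom htime hrad ψ hψ hemb hcont U Φ rp Pext R hRm hβ hα
      hδK hKO hHov hcov hlab y hyS₀ hyS₁ hyR hy₁ hKR

end Combined

end Summit.FinalStateConjecture.FinalStateConjecture.Theorems

end
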